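import Mathlib
import Summits.BirchSwinnertonDyer.BirchSwinnertonDyer.Theses.SignedLowerHalves
import Summits.BirchSwinnertonDyer.BirchSwinnertonDyer.Theorems.SignedLowerHalvesSmallImageMuZeroOneSignOfFacts
import Literature.NumberTheory.EllipticCurves.FineSelmerDivisionSubfieldMuRoad
import Literature.NumberTheory.EllipticCurves.FineSelmerCongruentCurves
import Literature.NumberTheory.EllipticCurves.QuadraticTwist
import HarnessLib

/-!
# Sketch — crux-ideate r1 g28, LENS A «recent-theorem open-question harvest» (item stmt-BirchSwinnertonDyer-23600)

Typed FIRST LEMMAS of the three harvested printed open questions (census `CENSUS-cruxideate-r1g28.md` §2),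
stated over EXISTING declarations only.  Nothing here restates or weakens the crux
`Theses.SignedLowerHalves.SmallImageMuZeroOneSign`; nothing here is asserted to hold; every `theorem` below is a
sorry-free composition with a door ALREADY in the tree (cited by name), recorded so the critic can see exactly
which wall each harvested question lands on.  BSD is proved for no curve by any of this.

* H1 (wall W2, Bullach–Hofer 2023 Rem. 6.8 / Deo–Ray–Sujatha 2023 p. 3 / BHKO 2024 Rem. 1.8): Iwasawa's classical
  `μ = 0` for the cyclotomic tower of ONE torsion-point field `ℚ(E[p])^{⟨σ̄⟩}` on M's domain at `p ≥ 5`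
  (= the `fine_pivot` carrier `TorsionPointFieldMuAt`, universally closed over the domain) ⟹ Conj A per pair, by the
  tree's anchor `CoatesSujatha2005.conjA_rat_of_exists_classicalMuVanishes_fixedField_zpowers`.
* H2 (wall W1, Pollack–Weston 2011 Rem. 4.2 (1) / LPP 2024 p. 13 / Constantinescu–Nordentoft 2020 + Lee–Sun 2019, fixed
  denominator): a unit `ω⁰` Teichmüller orbit sum at LOW layer `n ∈ {1, 2}` for every pair of the cut `p ∈ {5, 7, 11}`
  ⟹ the `hW` binder of `SmallImageMuZeroOneSignOfFacts.smallImageMuZeroOneSign_of_facts_of_orbitUnit_le_eleven_…`.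
* H3 (Euler-characteristic door on the twist orbit, Ono–Skinner 1998 / Ray–Sujatha 2021 Cor. 2.7): mod-`p` torsion is
  stable under the quadratic twist by the CM-shadow field, so Conj A transfers along it
  (`LimSujatha2018.prop32_…_holds`); a per-member INSTRUMENT, never a `∀`.
-/

set_option autoImplicit false

noncomputable section

open scoped Classical
open WeierstrassCurve Literature.NumberTheory.EllipticCurves Literature.NumberTheory.EllipticCurves.Rank1Residual
open Literature.NumberTheory.EllipticCurves.ModularForms CongruenceSubgroup
open NumberField Field IntermediateField
open Literature.NumberTheory.GaloisRepresentations Literature.NumberTheory.NumberFields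
  Literature.NumberTheory.EllipticCurves.ZpExtension Literature.NumberTheory.IwasawaTheory

namespace Summit.BirchSwinnertonDyer.BirchSwinnertonDyer.Cruxes.SmallImageMuZeroOneSign.OqhHarvest

/-! ## H1 — wall W2 typed: Iwasawa's `μ = 0` for one torsion-point field, on the domain at `p ≥ 5` -/

/-- **H1 (harvested: Bullach–Hofer 2023 Rem. 6.8, DRS 2023 p. 3, BHKO 2024 Rem. 1.8).**  For every pair of M's domain
with `p ≥ 5` there are `σ ∈ Γ_ℚ` and `P ∈ E[p] ∖ 0` with `σ • P = P` such that every cyclotomic `ℤ_p`-extension of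
`ℚ(E[p])^{⟨σ̄⟩}` has classical `μ = 0` (growth form).  OPEN (an instance of Iwasawa's conjecture for a non-abelian
field with ONE, totally ramified, prime above `p`); the universal closure over the domain of `fine_pivot`'s carrier
`TorsionPointFieldMuAt`.  A PREDICATE; nothing asserted. -/
def IwasawaMuZeroPointFieldOnDomain : Prop :=
  ∀ (W : WeierstrassCurve ℚ) [W.IsElliptic] [W.IsGloballyMinimal] (p : ℕ) [Fact p.Prime],
    5 ≤ p → ClassX7 W p → ¬ W.HasCM → W.frobeniusTrace p = 0 → ¬ Surj W p →
    haveI : NeZero p := ⟨(Fact.out : p.Prime).ne_zero⟩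
    haveI : NumberField ↥(W.divisionField p) := NumberField.mk
    ∃ (σ : Field.absoluteGaloisGroup ℚ) (P : W.geomTorsion p), P ≠ 0 ∧ σ • P = P ∧
      ∀ κL : ZpExtension ↥(fixedField (Subgroup.zpowers (absRestrictNormalHom (W.divisionField p) σ))) p,
        κL.IsCyclotomic → ClassicalMuVanishes κL

/-- **H1 lands on the tree's W2 door**: `H1 ⟹ Conj A` at every domain pair with `p ≥ 5`, given the two standing
hypotheses of the anchor (`E[p]` irreducible, `p ∤ #Gal(ℚ(E[p])/ℚ)` — both hold on the domain, image `⊆ N(C_ns(p))` of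
order dividing `2(p² − 1)`; discharged in `Theorems/SignedLowerHalvesSmallImageMuZeroOneSignClassNumberDoor`, not here).
Composition with `conjA_rat_of_exists_classicalMuVanishes_fixedField_zpowers`; then M's body at the pair is
`SmallImageFinePivot.oneSignMuZero_of_conjAAt` (p694552 `smallImageMuZeroOneSign_iff_conjA_onDomain`). -/
theorem conjAAt_of_iwasawaMuZeroPointField (h : IwasawaMuZeroPointFieldOnDomain)
    (W : WeierstrassCurve ℚ) [W.IsElliptic] [W.IsGloballyMinimal] (p : ℕ) [Fact p.Prime]
    (hp5 : 5 ≤ p) (hX : ClassX7 W p) (hCM : ¬ W.HasCM) (hap : W.frobeniusTrace p = 0) (hs : ¬ Surj W p)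
    (hirr : W.HasIrreducibleModPGaloisRep p)
    (hG : haveI : NeZero p := ⟨(Fact.out : p.Prime).ne_zero⟩
      ¬ p ∣ Nat.card ((W.divisionField p) ≃ₐ[ℚ] (W.divisionField p))) :
    ConjAAt W p :=
  CoatesSujatha2005.conjA_rat_of_exists_classicalMuVanishes_fixedField_zpowers W (by omega) hirr hG
    (h W p hp5 hX hCM hap hs)

/-! ## H2 — wall W1 typed at low layer: a unit `ω⁰` orbit sum at `n ∈ {1, 2}` on the cut `p ∈ {5, 7, 11}` -/

/-- **H2 (harvested: Pollack–Weston 2011 Rem. 4.2 (1), LPP 2024 p. 13, fixed-denominator residual equidistribution left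
open by Constantinescu–Nordentoft 2020 / Lee–Sun 2019).**  For every pair of the cut (`5 ≤ p ≤ 11`) and its conductor-level
newform `f`, SOME Teichmüller orbit sum `S_f(p, n, b)` with `n ∈ {1, 2}` and `b` a unit has `p`-adic norm `≥ 1`.
Decidable PAIR BY PAIR (finitely many exact modular symbols) — an INSTRUMENT; as a `∀` it is the packet law of wall W1
(census B-g2-2 / B-g5-3).  A PREDICATE; nothing asserted. -/
def OrbitUnitLowLayerOnCut : Prop :=
  ∀ (W : WeierstrassCurve ℚ) [W.IsElliptic] [W.IsGloballyMinimal] (p : ℕ) [Fact p.Prime],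
    5 ≤ p → p ≤ 11 → ClassX7 W p → ¬ W.HasCM → W.frobeniusTrace p = 0 → ¬ Surj W p →
    ∀ [NeZero (W.conductorNorm ℤ)] (f : CuspForm (Gamma0 (W.conductorNorm ℤ)) 2), IsNewformOf W f →
      ∃ n : ℕ, (n = 1 ∨ n = 2) ∧ ∃ b : (ZMod (p ^ n))ˣ,
        1 ≤ ‖((teichOrbitSum f p n (b : ZMod (p ^ n)) : ℚ) : ℚ_[p])‖

/-- **H2 feeds the tree's orbit-unit cut verbatim**: it supplies the binder `hW` of
`SmallImageMuZeroOneSignOfFacts.smallImageMuZeroOneSign_of_facts_of_orbitUnit_le_eleven_of_nonsplitCartanPointsAreCM`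
(crux M BY NAME modulo print, BDMTV and `NonsplitCartanPointsAreCM q` for `q ≥ 19`).  Pure logic. -/
theorem orbitUnit_le_eleven_of_lowLayer (h : OrbitUnitLowLayerOnCut) :
    ∀ (W : WeierstrassCurve ℚ) [W.IsElliptic] [W.IsGloballyMinimal] (p : ℕ) [Fact p.Prime],
      5 ≤ p → p ≤ 11 → ClassX7 W p → ¬ W.HasCM → W.frobeniusTrace p = 0 → ¬ Surj W p →
      ∀ [NeZero (W.conductorNorm ℤ)] (f : CuspForm (Gamma0 (W.conductorNorm ℤ)) 2), IsNewformOf W f →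
        ∃ n : ℕ, 1 ≤ n ∧ ∃ b : (ZMod (p ^ n))ˣ,
          1 ≤ ‖((teichOrbitSum f p n (b : ZMod (p ^ n)) : ℚ) : ℚ_[p])‖ := by
  intro W _ _ p _ hp5 h11 hX hCM hap hs _ f hf
  obtain ⟨n, hn, b, hb⟩ := h W p hp5 h11 hX hCM hap hs f hf
  exact ⟨n, by omega, b, hb⟩

/-! ## H3 — the twist-orbit door: mod-`p` torsion is twist-stable on the domain, so Conj A moves along the twist -/

/-- **H3 (harvested: the Euler-characteristic / Ray–Sujatha door read on the TWIST ORBIT, Ono–Skinner 1998).**  On M's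
domain (`a_p = 0`, image `⊆ N(C_ns(p))`, so `ρ̄ ≅ ρ̄ ⊗ ε_K` for the quadratic CM-shadow field `K`), SOME non-trivial
quadratic twist `E^{(d)}` has `E^{(d)}[p] ≅ E[p]` as a Galois module.  Expected PROVABLE (take `d = disc K`); typed as the
equivariant additive equivalence the tree's congruence transfer consumes.  A PREDICATE; nothing asserted. -/
def TwistStableTorsionOnDomain : Prop :=
  ∀ (W : WeierstrassCurve ℚ) [W.IsElliptic] [W.IsGloballyMinimal] (p : ℕ) [Fact p.Prime], p ≠ 2 →
    ClassX7 W p → ¬ W.HasCM → W.frobeniusTrace p = 0 → ¬ Surj W p →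
    ∃ d : ℚ, d ≠ 0 ∧ ¬ IsSquare d ∧ ∃ _ : (W.quadraticTwist d).IsElliptic,
      ∃ e : W.geomTorsion (p : ℤ) ≃+ (W.quadraticTwist d).geomTorsion (p : ℤ),
        ∀ (σ : Field.absoluteGaloisGroup ℚ) (P : W.geomTorsion (p : ℤ)), e (σ • P) = σ • e P

/-- **H3 lands on the tree's congruence transfer**: Conj A for the twist `E^{(d)}` gives Conj A for `E`
(`LimSujatha2018.prop32_fineSelmerDual_moduleFinite_iff_of_torsionIso_holds`, as in `Lines/rs_road.lean`
`conjAAt_of_congruent`); composed with the Euler-characteristic door `conjAAt_of_not_dvd_card_of_not_dvd_shaOrder` on a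
rank-zero member of the orbit this is a PER-MEMBER certificate (instrument), never the crux. -/
theorem conjAAt_transfer_along_twist (hT : TwistStableTorsionOnDomain) (W : WeierstrassCurve ℚ) [W.IsElliptic]
    [W.IsGloballyMinimal] (p : ℕ) [Fact p.Prime] (hp2 : p ≠ 2) (hX : ClassX7 W p) (hCM : ¬ W.HasCM) (hap : W.frobeniusTrace p = 0)
    (hs : ¬ Surj W p) :
    ∃ d : ℚ, d ≠ 0 ∧ ¬ IsSquare d ∧ ∃ _ : (W.quadraticTwist d).IsElliptic,
      (ConjAAt (W.quadraticTwist d) p → ConjAAt W p) := by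
  obtain ⟨d, hd0, hd, hE, e, he⟩ := hT W p hp2 hX hCM hap hs
  refine ⟨d, hd0, hd, hE, fun hA' κ hκ => ?_⟩
  exact (LimSujatha2018.prop32_fineSelmerDual_moduleFinite_iff_of_torsionIso_holds W (W.quadraticTwist d) p hp2
    ⟨e, he⟩ κ hκ).mpr (hA' κ hκ)

end Summit.BirchSwinnertonDyer.BirchSwinnertonDyer.Cruxes.SmallImageMuZeroOneSign.OqhHarvest

end
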